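import Literature.NumberTheory.CubicFields.FundCubicFieldCountLandau
import Literature.NumberTheory.QuadraticFields.ThreeTorsionMeanSquarefreeCount
import Mathlib.NumberTheory.Bertrand
import Mathlib.Analysis.Real.Pi.Bounds
import HarnessLib

/-!
# BTT §5, the `E₂` paragraph: the Landau–Shintani input from Theorem 3.2 (averaged Landau), the residue formulas and Proposition 5.1

Topic `Literature/NumberTheory/CubicFields`; refines `FundCubicFieldCountLandau.LandauShintaniData` — whose
field `landau` packages the dyadic-block bound `Σ_{q∈[Q₁,2Q₁]} |N(q;X) − r₁X − r₂X^{5/6}| ≪ X^{3/5+ε} Q₁^{1/5}`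
— into the three inputs Bhargava–Taniguchi–Thorne 2023, §5 actually combine to get it:

* **Theorem 3.2** (the averaged form of Landau's method, [LDTT, Remark 9]) for the family
  `{ξ^s(·, Ψ_{q²})}_{q ∈ I}`: if each member satisfies (16) `|Res_{5/6}| ≪ X^{1/6} Res_1` and the family
  satisfies (19) `Σ δ̂₁ ≪ X Σ δ₁`, then `Σ_{q∈I} |N(q;X) − δ₁(q) X − r₂(q) X^{5/6}| ≪ X^{3/5} (Σ δ₁)^{3/5} (Σ δ̂₁)^{2/5}`
  (field `landauAvg`, the implied constant depending on the constants in (16), (19));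
* **the residue formulas (13), (15), (eq:res_p2)**: `q^{-2} ≪ δ₁(Ψ_{q²}) ≪_η q^{-2+η}`,
  `r₂(Ψ_{q²}) ≪_η q^{-5/3+η}`, `Σ_q μ(q) δ₁(Ψ_{q²}) = A` (fields `r₁_lower`, `abs_r₁_le`, `abs_r₂_le`, `hasSum_moebius_mul_r₁`);
* **Proposition 5.1**: `Σ_{q ∈ [Q,2Q]} δ̂₁(Ψ_{q²}) ≪_ε Q^{2+ε}` (field `sum_dhat_le`).

`ShintaniFamilyInput.toLandauShintaniData` PROVES `LandauShintaniData s A` from these, i.e. BTT's lines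
"E₂ ≪ X^{3/5+ε} Σ_{Q₁} (Σ δ₁)^{3/5} (Σ δ̂₁)^{2/5} provided that (19) is satisfied … yielding a total
contribution ≪ Q₁^{1/5+ε} … Q = X^{1/3−ε}, which is acceptable in (19)", including the two facts this
silently uses: `δ₁(Ψ_{q²}) ≫ q^{-2}` and **a positive proportion of every dyadic block is squarefree**
(`card_squarefree_Ico_ge`, from the tree's squarefree count `abs_card_squarefree_modEq_sub_le` for
`Q ≥ 256` and Bertrand's postulate below). Hence (`btt_fundCubicFieldCount_sum_of_shintaniFamilyInput`)
display (3) follows from `ShintaniFamilyInput (∓1) (3/π², 2/π²)` and `btt_uniformity_sqDvd`.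

What remains hypothetical is thus exactly: Thm 2.4 (Shintani–Datskovsky–Wright: continuation, functional
equation, residues of `ξ^±(s, Φ_m)`), Thm 3.1/3.2 ([LDTT]: Landau's method, uniformly in the functional
equation) and Prop. 5.1 (Fourier transforms of `Ψ_{p²}`), none of which is in Mathlib.

## References

* M. Bhargava, T. Taniguchi, F. Thorne, *Improved error estimates for the Davenport–Heilbronn theorems*,
  Math. Ann. 389 (2024) = arXiv:2107.12819, Thm 2.4, Thm 3.1/3.2, Remark 3.3, (16)–(19), Prop. 5.1, §5
  [BhargavaTaniguchiThorne2023].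
* D. Lowry-Duda, T. Taniguchi, F. Thorne, *Uniform bounds for lattice point counting and partial sums of
  zeta functions*, Math. Z. 300 (2022) 2571–2590 = arXiv:1710.02190, Thm 2 and Remark 9 [LDTT].
-/

noncomputable section

open Finset Real ArithmeticFunction
open scoped ArithmeticFunction.Moebius

namespace Literature.NumberTheory.CubicFields

open Literature.NumberTheory.QuadraticFields Classical

/-! ### A positive proportion of every dyadic block is squarefree -/

/-- The squarefree integers in `[Q, 2Q)`, counted in `ℤ` (as the tree's squarefree count does) and in `ℕ`. [folklore] -/
theorem card_squarefree_Ico_int_eq (Q : ℕ) :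
    ((Finset.Ico (Q : ℤ) ((2 * Q : ℕ) : ℤ)).filter (fun x => x ≡ 0 [ZMOD ((1 : ℕ) : ℤ)] ∧ Squarefree x)).card =
      ((Finset.Ico Q (2 * Q)).filter Squarefree).card := by
  symm
  refine Finset.card_bij' (fun n _ => (n : ℤ)) (fun x _ => x.toNat) ?_ ?_ ?_ ?_
  · intro n hn
    rw [Finset.mem_filter, Finset.mem_Ico] at hn ⊢
    exact ⟨⟨by exact_mod_cast hn.1.1, by exact_mod_cast hn.1.2⟩, by rw [Nat.cast_one]; exact Int.modEq_one,
      Int.squarefree_natCast.mpr hn.2⟩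
  · intro x hx
    rw [Finset.mem_filter, Finset.mem_Ico] at hx ⊢
    have hx0 : 0 ≤ x := le_trans (by positivity) hx.1.1
    have hxn : ((x.toNat : ℕ) : ℤ) = x := Int.toNat_of_nonneg hx0
    refine ⟨⟨?_, ?_⟩, ?_⟩
    · have := hx.1.1; omega
    · have := hx.1.2; omega
    · have h := hx.2.2
      rw [← hxn, Int.squarefree_natCast] at h
      exact h
  · intro n _; simp
  · intro x hx
    rw [Finset.mem_filter, Finset.mem_Ico] at hx
    exact Int.toNat_of_nonneg (le_trans (by positivity) hx.1.1)

/-- **Squarefree count in a dyadic block, `Q ≥ 256`: at least `Q/8`** — the tree's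
`#{squarefree in [a,b)} = (6/π²)(b−a) + O(5√M)` with `6/π² > 0.6` and `5√(2Q) ≤ 0.475·Q`. [folklore] -/
theorem card_squarefree_Ico_ge_of_le {Q : ℕ} (hQ : 256 ≤ Q) :
    (Q : ℝ) / 8 ≤ (((Finset.Ico Q (2 * Q)).filter Squarefree).card : ℝ) := by
  have hQpos : (0 : ℤ) < Q := by exact_mod_cast (show 0 < Q by omega)
  have h := abs_card_squarefree_modEq_sub_le (L := 1) Nat.one_pos (c := 0) (by simp)
    (a := (Q : ℤ)) (b := ((2 * Q : ℕ) : ℤ)) (by push_cast; omega) (Or.inr hQpos) (M := 2 * Q)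
    (by rw [Int.natAbs_natCast]; omega) (by rw [Int.natAbs_natCast])
  rw [card_squarefree_Ico_int_eq Q, Nat.primeFactors_one, Finset.prod_empty] at h
  have hmain : (6 / Real.pi ^ 2 : ℝ) * Q - 5 * Real.sqrt (2 * Q : ℕ) ≤ (((Finset.Ico Q (2 * Q)).filter Squarefree).card : ℝ) := by
    have h' := (abs_le.mp h).1
    push_cast at h' ⊢
    nlinarith [h']
  -- `6/π² > 0.6`
  have hpi : (0.6 : ℝ) ≤ 6 / Real.pi ^ 2 := by
    rw [le_div_iff₀ (by positivity)]
    nlinarith [Real.pi_lt_d2, Real.pi_pos]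
  -- `5 √(2Q) ≤ 0.475 Q` for `Q ≥ 256`
  have hQ' : (256 : ℝ) ≤ Q := by exact_mod_cast hQ
  have hsqrt : Real.sqrt (2 * Q : ℕ) ≤ (Q : ℝ) / 11 := by
    rw [Real.sqrt_le_left (by positivity)]
    push_cast
    nlinarith
  have hQ0 : (0 : ℝ) ≤ Q := by positivity
  calc (Q : ℝ) / 8 ≤ 0.6 * Q - 5 * (Q / 11) := by linarith
    _ ≤ 6 / Real.pi ^ 2 * Q - 5 * Real.sqrt (2 * Q : ℕ) := by nlinarith
    _ ≤ _ := hmain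

/-- **Squarefree count in a dyadic block, all `Q ≥ 1`: at least `Q/256`** (for `Q < 256` a prime in
`(Q, 2Q)` by Bertrand's postulate, or `1` itself when `Q = 1`). [folklore] -/
theorem card_squarefree_Ico_ge {Q : ℕ} (hQ : 1 ≤ Q) :
    (Q : ℝ) / 256 ≤ (((Finset.Ico Q (2 * Q)).filter Squarefree).card : ℝ) := by
  by_cases h256 : 256 ≤ Q
  · have := card_squarefree_Ico_ge_of_le h256
    have hQ0 : (0 : ℝ) ≤ Q := by positivity
    linarith
  · -- one squarefree element suffices
    have hone : 1 ≤ ((Finset.Ico Q (2 * Q)).filter Squarefree).card := by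
      rw [Nat.one_le_iff_ne_zero, Ne, Finset.card_eq_zero, ← Ne, ← Finset.nonempty_iff_ne_empty]
      rcases eq_or_lt_of_le hQ with h1 | h1
      · refine ⟨1, ?_⟩
        rw [Finset.mem_filter, Finset.mem_Ico]
        exact ⟨⟨by omega, by omega⟩, squarefree_one⟩
      · obtain ⟨p, hp, hQp, hp2⟩ := Nat.exists_prime_lt_and_le_two_mul Q (by omega)
        refine ⟨p, ?_⟩
        rw [Finset.mem_filter, Finset.mem_Ico]
        refine ⟨⟨hQp.le, lt_of_le_of_ne hp2 ?_⟩, hp.squarefree⟩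
        rintro rfl
        exact (Nat.not_prime_mul (by norm_num) (by omega)) hp
    have hQ' : (Q : ℝ) < 256 := by exact_mod_cast (not_le.mp h256)
    have hone' : (1 : ℝ) ≤ ((Finset.Ico Q (2 * Q)).filter Squarefree).card := by exact_mod_cast hone
    linarith

/-! ### The three inputs of the `E₂` paragraph -/

/-- **The inputs of BTT §5's `E₂`/`E₁` estimates for the family `{ξ^s(·, Ψ_{q²})}_{q squarefree}`**, as
printed: `r₁(q) = δ₁(Ψ_{q²}) := Res_{s=1} ξ^s(s, Ψ_{q²})`, `r₂(q) := (6/5)·Res_{s=5/6} ξ^s(s, Ψ_{q²})`,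
`dhat q := δ̂₁(Ψ_{q²})` ((18)), subject to
* `r₁_lower`, `abs_r₁_le`, `abs_r₂_le`, `hasSum_moebius_mul_r₁` — the residue formulas (13), (15),
  (eq:res_p2): `α^s q⁻² ≤ α^s ∏_{p∣q}(2p⁻² − p⁻⁴) ≤ δ₁(Ψ_{q²}) ≪_η q^{-2+η}`, `r₂ ≪_η q^{-5/3+η}`, and (21)
  `Σ_q μ(q) δ₁(Ψ_{q²}) = A`;
* `sum_dhat_le` — **Proposition 5.1**: `Σ_{q∈[Q,2Q]} δ̂₁(Ψ_{q²}) ≪_ε Q^{2+ε}`;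
* `landauAvg` — **Theorem 3.2** (Landau's method, averaged over a family with a common functional
  equation, [LDTT, Remark 9]) for the sub-families indexed by finite sets `I` of squarefree `q`: if every
  member satisfies (16) `|r₂(q)| ≤ c'·X^{1/6}·δ₁(q)` and the family satisfies (19) `Σ_I δ̂₁ ≤ c·X·Σ_I δ₁`, then
  `Σ_{q∈I} |N^s(X, Ψ_{q²}) − δ₁(q) X − r₂(q) X^{5/6}| ≤ C(c, c') · X^{3/5} (Σ_I δ₁)^{3/5} (Σ_I δ̂₁)^{2/5}`.
(A hypothesis structure, not a named fact: these are Thm 2.4 + Thm 3.2 + Prop 5.1 of the source, whose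
proofs — Sato–Shintani theory, [LDTT], finite Fourier analysis on `V(ℤ/p²ℤ)` — are not in Mathlib.)
[cite: BhargavaTaniguchiThorne2023, Thm 2.4 (13)–(15), (eq:res_p2), Thm 3.2 with (16)–(19), Prop. 5.1, (21)] -/
structure ShintaniFamilyInput (s : ℤ) (A : ℝ) where
  /-- `δ₁(q) := Res_{s=1} ξ^s(s, Ψ_{q²})`. -/
  r₁ : ℕ → ℝ
  /-- `r₂(q) := (6/5) · Res_{s=5/6} ξ^s(s, Ψ_{q²})`. -/
  r₂ : ℕ → ℝ
  /-- `δ̂₁(q) := δ̂₁(Ψ_{q²}) = sup_Z Z⁻¹ Σ_{n<Z} m⁸ |b(Ψ̂_{q²}, n)|`, the density of the dual (18). -/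
  dhat : ℕ → ℝ
  /-- (13) + (eq:res_p2): `δ₁(Ψ_{q²}) ≥ α^s ∏_{p∣q} (2p⁻² − p⁻⁴) ≥ α^s q⁻²`. -/
  r₁_lower : ∃ c₁ : ℝ, 0 < c₁ ∧ ∀ q : ℕ, Squarefree q → c₁ * (q : ℝ) ^ (-2 : ℝ) ≤ r₁ q
  /-- (13) + (15) + (eq:res_p2): `δ₁(Ψ_{q²}) ≪_η q^{-2+η}`. -/
  abs_r₁_le : ∀ η : ℝ, 0 < η → ∃ C₁ : ℝ, ∀ q : ℕ, Squarefree q → |r₁ q| ≤ C₁ * (q : ℝ) ^ (-2 + η)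
  /-- (21): `Σ_q μ(q) δ₁(Ψ_{q²}) = A` (`= 3/π²` for `s = -1`, `2/π²` for `s = 1`). -/
  hasSum_moebius_mul_r₁ : HasSum (fun q : ℕ => ((μ q : ℤ) : ℝ) * r₁ q) A
  /-- (13) + (15) + (eq:res_p2): `Res_{5/6} ξ^s(s, Ψ_{q²}) ≪_η q^{-5/3+η}`. -/
  abs_r₂_le : ∀ η : ℝ, 0 < η → ∃ C₂ : ℝ, ∀ q : ℕ, Squarefree q → |r₂ q| ≤ C₂ * (q : ℝ) ^ (-(5 : ℝ) / 3 + η)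
  /-- `δ̂₁ ≥ 0` (a supremum of nonnegative quantities). -/
  dhat_nonneg : ∀ q : ℕ, 0 ≤ dhat q
  /-- **Proposition 5.1**: `Σ_{q ∈ [Q, 2Q]} δ̂₁(Ψ_{q²}) ≪_ε Q^{2+ε}`. -/
  sum_dhat_le : ∀ η : ℝ, 0 < η → ∃ C : ℝ, ∀ Q : ℕ, 1 ≤ Q →
    ∑ q ∈ (Finset.Ico Q (2 * Q)).filter Squarefree, dhat q ≤ C * (Q : ℝ) ^ (2 + η)
  /-- **Theorem 3.2** for the family `{ξ^s(·, Ψ_{q²})}_{q ∈ I}` under (16) (constant `c'`) and (19) (constant `c`). -/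
  landauAvg : ∀ c : ℝ, 0 < c → ∀ c' : ℝ, 0 < c' → ∃ C : ℝ, ∀ X : ℕ, 1 ≤ X → ∀ I : Finset ℕ,
    (∀ q ∈ I, Squarefree q) → (∀ q ∈ I, |r₂ q| ≤ c' * (X : ℝ) ^ ((1 : ℝ) / 6) * r₁ q) →
    ∑ q ∈ I, dhat q ≤ c * X * ∑ q ∈ I, r₁ q →
    ∑ q ∈ I, |nonFundCount s q X - r₁ q * X - r₂ q * (X : ℝ) ^ ((5 : ℝ) / 6)|
      ≤ C * (X : ℝ) ^ ((3 : ℝ) / 5) * (∑ q ∈ I, r₁ q) ^ ((3 : ℝ) / 5) * (∑ q ∈ I, dhat q) ^ ((2 : ℝ) / 5)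

namespace ShintaniFamilyInput

variable {s : ℤ} {A : ℝ}

/-- Members of the dyadic block: squarefree, `Q₁ ≤ q < 2Q₁`, `0 < q`. [folklore] -/
theorem mem_block {Q₁ q : ℕ} (hQ₁ : 1 ≤ Q₁) (hq : q ∈ (Finset.Ico Q₁ (2 * Q₁)).filter Squarefree) :
    Squarefree q ∧ (Q₁ : ℝ) ≤ q ∧ (q : ℝ) < 2 * Q₁ ∧ (0 : ℝ) < q := by
  rw [Finset.mem_filter, Finset.mem_Ico] at hq
  have hq0 : 0 < q := lt_of_lt_of_le hQ₁ hq.1.1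
  exact ⟨hq.2, by exact_mod_cast hq.1.1, by exact_mod_cast hq.1.2, by exact_mod_cast hq0⟩

/-- **(19) holds on dyadic blocks in the range `Q₁ ≤ X^{1/3−ε}`, lower side**:
`Σ_{q ∈ [Q₁,2Q₁) sqfree} δ₁(q) ≥ (c₁/1024) · Q₁⁻¹` (`δ₁(q) ≥ c₁ q⁻² > c₁/(4Q₁²)` on `≥ Q₁/256` squarefree `q`). [folklore] -/
theorem sum_block_r₁_ge (h : ShintaniFamilyInput s A) {c₁ : ℝ} (hc₁ : 0 < c₁)
    (hlow : ∀ q : ℕ, Squarefree q → c₁ * (q : ℝ) ^ (-2 : ℝ) ≤ h.r₁ q) {Q₁ : ℕ} (hQ₁ : 1 ≤ Q₁) :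
    c₁ / 1024 * (Q₁ : ℝ)⁻¹ ≤ ∑ q ∈ (Finset.Ico Q₁ (2 * Q₁)).filter Squarefree, h.r₁ q := by
  have hQpos : (0 : ℝ) < Q₁ := by exact_mod_cast hQ₁
  have hcard := card_squarefree_Ico_ge hQ₁
  have hterm : ∀ q ∈ (Finset.Ico Q₁ (2 * Q₁)).filter Squarefree, c₁ / (4 * (Q₁ : ℝ) ^ 2) ≤ h.r₁ q := by
    intro q hq
    obtain ⟨hsq, hQq, hq2, hq0⟩ := mem_block hQ₁ hq
    refine le_trans ?_ (hlow q hsq)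
    rw [Real.rpow_neg hq0.le, Real.rpow_two, div_eq_mul_inv]
    refine mul_le_mul_of_nonneg_left ?_ hc₁.le
    exact inv_anti₀ (by positivity) (by nlinarith)
  calc c₁ / 1024 * (Q₁ : ℝ)⁻¹ = ((Q₁ : ℝ) / 256) * (c₁ / (4 * (Q₁ : ℝ) ^ 2)) := by field_simp; ring
    _ ≤ ((((Finset.Ico Q₁ (2 * Q₁)).filter Squarefree).card : ℕ) : ℝ) * (c₁ / (4 * (Q₁ : ℝ) ^ 2)) :=
        mul_le_mul_of_nonneg_right hcard (by positivity)
    _ = ∑ _q ∈ (Finset.Ico Q₁ (2 * Q₁)).filter Squarefree, c₁ / (4 * (Q₁ : ℝ) ^ 2) := by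
        rw [Finset.sum_const, nsmul_eq_mul]
    _ ≤ _ := Finset.sum_le_sum hterm

/-- Upper side: `Σ_{q ∈ [Q₁,2Q₁) sqfree} δ₁(q) ≤ C₁ · Q₁^{-1+η}` for `0 ≤ C₁`, `η ≤ 2` (at most `Q₁` terms, each `≤ C₁ Q₁^{-2+η}`). [folklore] -/
theorem sum_block_r₁_le (h : ShintaniFamilyInput s A) {C₁ η : ℝ} (hC₁ : 0 ≤ C₁) (hη : η ≤ 2)
    (hup : ∀ q : ℕ, Squarefree q → |h.r₁ q| ≤ C₁ * (q : ℝ) ^ (-2 + η)) {Q₁ : ℕ} (hQ₁ : 1 ≤ Q₁) :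
    ∑ q ∈ (Finset.Ico Q₁ (2 * Q₁)).filter Squarefree, h.r₁ q ≤ C₁ * (Q₁ : ℝ) ^ (-1 + η) := by
  have hQpos : (0 : ℝ) < Q₁ := by exact_mod_cast hQ₁
  have hterm : ∀ q ∈ (Finset.Ico Q₁ (2 * Q₁)).filter Squarefree, h.r₁ q ≤ C₁ * (Q₁ : ℝ) ^ (-2 + η) := by
    intro q hq
    obtain ⟨hsq, hQq, -, -⟩ := mem_block hQ₁ hq
    calc h.r₁ q ≤ |h.r₁ q| := le_abs_self _
      _ ≤ C₁ * (q : ℝ) ^ (-2 + η) := hup q hsq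
      _ ≤ C₁ * (Q₁ : ℝ) ^ (-2 + η) :=
          mul_le_mul_of_nonneg_left (Real.rpow_le_rpow_of_nonpos hQpos hQq (by linarith)) hC₁
  have hcard : (((Finset.Ico Q₁ (2 * Q₁)).filter Squarefree).card : ℝ) ≤ Q₁ := by
    have h1 : ((Finset.Ico Q₁ (2 * Q₁)).filter Squarefree).card ≤ (Finset.Ico Q₁ (2 * Q₁)).card :=
      Finset.card_filter_le _ _
    rw [Nat.card_Ico] at h1
    have h2 : 2 * Q₁ - Q₁ = Q₁ := by omega
    rw [h2] at h1
    exact_mod_cast h1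
  calc ∑ q ∈ (Finset.Ico Q₁ (2 * Q₁)).filter Squarefree, h.r₁ q
      ≤ ∑ _q ∈ (Finset.Ico Q₁ (2 * Q₁)).filter Squarefree, C₁ * (Q₁ : ℝ) ^ (-2 + η) := Finset.sum_le_sum hterm
    _ = (((Finset.Ico Q₁ (2 * Q₁)).filter Squarefree).card : ℝ) * (C₁ * (Q₁ : ℝ) ^ (-2 + η)) := by
        rw [Finset.sum_const, nsmul_eq_mul]
    _ ≤ (Q₁ : ℝ) * (C₁ * (Q₁ : ℝ) ^ (-2 + η)) := mul_le_mul_of_nonneg_right hcard (by positivity)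
    _ = C₁ * ((Q₁ : ℝ) ^ (1 : ℝ) * (Q₁ : ℝ) ^ (-2 + η)) := by rw [Real.rpow_one]; ring
    _ = C₁ * (Q₁ : ℝ) ^ (-1 + η) := by rw [← Real.rpow_add hQpos]; ring_nf

/-- **(16) holds in the range `q < 2Q₁ ≤ 2X^{1/3}`** (Remark 3.3): `|r₂(q)| ≤ C₂ q^{-3/2} ≤ (2C₂/c₁)·X^{1/6}·c₁q⁻²
≤ c'·X^{1/6}·δ₁(q)` since `q^{1/2} ≤ 2X^{1/6}`. [cite: BhargavaTaniguchiThorne2023, Remark 3.3 with (13), (eq:res_p2)] -/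
theorem cond16 (h : ShintaniFamilyInput s A) {c₁ C₂ : ℝ} (hc₁ : 0 < c₁) (hC₂ : 0 ≤ C₂)
    (hlow : ∀ q : ℕ, Squarefree q → c₁ * (q : ℝ) ^ (-2 : ℝ) ≤ h.r₁ q)
    (hup : ∀ q : ℕ, Squarefree q → |h.r₂ q| ≤ C₂ * (q : ℝ) ^ (-(5 : ℝ) / 3 + 1 / 6))
    {X : ℕ} (hX : 1 ≤ X) {Q₁ : ℕ} (hQ₁ : 1 ≤ Q₁) (hQX : (Q₁ : ℝ) ≤ (X : ℝ) ^ ((1 : ℝ) / 3))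
    {q : ℕ} (hq : q ∈ (Finset.Ico Q₁ (2 * Q₁)).filter Squarefree) :
    |h.r₂ q| ≤ (2 * C₂ / c₁ + 1) * (X : ℝ) ^ ((1 : ℝ) / 6) * h.r₁ q := by
  obtain ⟨hsq, -, hq2, hq0⟩ := mem_block hQ₁ hq
  have hX0 : (0 : ℝ) < X := by exact_mod_cast hX
  have hX16 : 0 < (X : ℝ) ^ ((1 : ℝ) / 6) := Real.rpow_pos_of_pos hX0 _
  -- `q^{1/2} ≤ 2 X^{1/6}`
  have hqhalf : (q : ℝ) ^ ((1 : ℝ) / 2) ≤ 2 * (X : ℝ) ^ ((1 : ℝ) / 6) := by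
    have h1 : (q : ℝ) ≤ 4 * (X : ℝ) ^ ((1 : ℝ) / 3) := by nlinarith [Real.rpow_nonneg hX0.le ((1 : ℝ) / 3)]
    have h2 : (q : ℝ) ^ ((1 : ℝ) / 2) ≤ (4 * (X : ℝ) ^ ((1 : ℝ) / 3)) ^ ((1 : ℝ) / 2) :=
      Real.rpow_le_rpow hq0.le h1 (by norm_num)
    have h3 : (4 * (X : ℝ) ^ ((1 : ℝ) / 3)) ^ ((1 : ℝ) / 2) = 2 * (X : ℝ) ^ ((1 : ℝ) / 6) := by
      rw [Real.mul_rpow (by norm_num) (Real.rpow_nonneg hX0.le _), ← Real.rpow_mul hX0.le]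
      have h4 : (4 : ℝ) ^ ((1 : ℝ) / 2) = 2 := by
        rw [show (4 : ℝ) = 2 ^ (2 : ℝ) by norm_num, ← Real.rpow_mul (by norm_num)]; norm_num
      rw [h4]; norm_num
    linarith
  -- `q^{-3/2} = q^{-2} · q^{1/2}`
  have hsplit : (q : ℝ) ^ (-(5 : ℝ) / 3 + 1 / 6) = (q : ℝ) ^ (-2 : ℝ) * (q : ℝ) ^ ((1 : ℝ) / 2) := by
    rw [← Real.rpow_add hq0]; norm_num
  have hr₁ : c₁ * (q : ℝ) ^ (-2 : ℝ) ≤ h.r₁ q := hlow q hsq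
  have hq2pos : 0 < (q : ℝ) ^ (-2 : ℝ) := Real.rpow_pos_of_pos hq0 _
  calc |h.r₂ q| ≤ C₂ * (q : ℝ) ^ (-(5 : ℝ) / 3 + 1 / 6) := hup q hsq
    _ = C₂ * (q : ℝ) ^ (-2 : ℝ) * (q : ℝ) ^ ((1 : ℝ) / 2) := by rw [hsplit, mul_assoc]
    _ ≤ C₂ * (q : ℝ) ^ (-2 : ℝ) * (2 * (X : ℝ) ^ ((1 : ℝ) / 6)) :=
        mul_le_mul_of_nonneg_left hqhalf (by positivity)
    _ = (2 * C₂ / c₁) * (X : ℝ) ^ ((1 : ℝ) / 6) * (c₁ * (q : ℝ) ^ (-2 : ℝ)) := by field_simp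
    _ ≤ (2 * C₂ / c₁) * (X : ℝ) ^ ((1 : ℝ) / 6) * h.r₁ q :=
        mul_le_mul_of_nonneg_left hr₁ (by positivity)
    _ ≤ (2 * C₂ / c₁ + 1) * (X : ℝ) ^ ((1 : ℝ) / 6) * h.r₁ q := by
        have hr₁0 : 0 ≤ h.r₁ q := le_trans (by positivity) hr₁
        have : 0 ≤ (X : ℝ) ^ ((1 : ℝ) / 6) * h.r₁ q := by positivity
        nlinarith

/-- `Q₁^{3+ε'} ≤ X` when `Q₁ ≤ X^{1/3−ε}`, `0 < ε' ≤ ε`, `X ≥ 1` — the range in which (19) is "acceptable". [folklore] -/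
theorem rpow_three_add_le {X Q₁ ε ε' : ℝ} (hX : 1 ≤ X) (hQ₁ : 0 ≤ Q₁) (hε' : 0 < ε') (hε'ε : ε' ≤ ε)
    (hQX : Q₁ ≤ X ^ ((1 : ℝ) / 3 - ε)) : Q₁ ^ (3 + ε') ≤ X := by
  have hX0 : 0 ≤ X := by linarith
  calc Q₁ ^ (3 + ε') ≤ (X ^ ((1 : ℝ) / 3 - ε)) ^ (3 + ε') := Real.rpow_le_rpow hQ₁ hQX (by linarith)
    _ = X ^ (((1 : ℝ) / 3 - ε) * (3 + ε')) := by rw [← Real.rpow_mul hX0]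
    _ ≤ X ^ (1 : ℝ) := by
        refine Real.rpow_le_rpow_of_exponent_le hX ?_
        nlinarith
    _ = X := Real.rpow_one X

/-- **BTT §5, the `E₂` paragraph, PROVED from Thm 3.2 + the residue bounds + Prop 5.1**: for `0 < ε`,
`1 ≤ Q₁ ≤ X^{1/3−ε}`: `Σ_{q ∈ [Q₁,2Q₁) sqfree} |N^s(X,Ψ_{q²}) − δ₁(q)X − r₂(q)X^{5/6}| ≤ C·X^{3/5+ε}·Q₁^{1/5}`
("(Σδ₁)^{3/5}(Σδ̂₁)^{2/5} ≪ Q₁^{(−1+ε)3/5}·Q₁^{(2+ε)2/5} ≪ Q₁^{1/5+ε}, provided that (19) is satisfied …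
Q = X^{1/3−ε} is acceptable in (19)"). [cite: BhargavaTaniguchiThorne2023, §5 (E₂ ≪ X^{3/5+ε} Σ_{Q₁} (Σδ₁)^{3/5}(Σδ̂₁)^{2/5}, (19) acceptable for Q = X^{1/3−ε})] -/
theorem landau (h : ShintaniFamilyInput s A) (ε : ℝ) (hε : 0 < ε) :
    ∃ C : ℝ, ∀ X : ℕ, 1 ≤ X → ∀ Q₁ : ℕ, 1 ≤ Q₁ → (Q₁ : ℝ) ≤ (X : ℝ) ^ ((1 : ℝ) / 3 - ε) →
      ∑ q ∈ (Finset.Ico Q₁ (2 * Q₁)).filter Squarefree,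
          |nonFundCount s q X - h.r₁ q * X - h.r₂ q * (X : ℝ) ^ ((5 : ℝ) / 6)|
        ≤ C * (X : ℝ) ^ ((3 : ℝ) / 5 + ε) * (Q₁ : ℝ) ^ ((1 : ℝ) / 5) := by
  -- constants
  set ε' : ℝ := min ε (1 / 6) with hε'_def
  have hε' : 0 < ε' := lt_min hε (by norm_num)
  have hε'ε : ε' ≤ ε := min_le_left _ _
  have hε'6 : ε' ≤ 1 / 6 := min_le_right _ _
  obtain ⟨c₁, hc₁, hlow⟩ := h.r₁_lower
  obtain ⟨C₁, hC₁⟩ := h.abs_r₁_le ε' hε'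
  obtain ⟨C₂, hC₂⟩ := h.abs_r₂_le (1 / 6) (by norm_num)
  obtain ⟨C_P, hP⟩ := h.sum_dhat_le ε' hε'
  set C₁' : ℝ := max C₁ 0 with hC₁'_def
  set C₂' : ℝ := max C₂ 0 with hC₂'_def
  set C_P' : ℝ := max C_P 1 with hC_P'_def
  have hC₁'0 : 0 ≤ C₁' := le_max_right _ _
  have hC₂'0 : 0 ≤ C₂' := le_max_right _ _
  have hC_P'1 : 1 ≤ C_P' := le_max_right _ _
  have hup₁ : ∀ q : ℕ, Squarefree q → |h.r₁ q| ≤ C₁' * (q : ℝ) ^ (-2 + ε') := fun q hq =>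
    (hC₁ q hq).trans (mul_le_mul_of_nonneg_right (le_max_left _ _) (Real.rpow_nonneg (Nat.cast_nonneg _) _))
  have hup₂ : ∀ q : ℕ, Squarefree q → |h.r₂ q| ≤ C₂' * (q : ℝ) ^ (-(5 : ℝ) / 3 + 1 / 6) := fun q hq =>
    (hC₂ q hq).trans (mul_le_mul_of_nonneg_right (le_max_left _ _) (Real.rpow_nonneg (Nat.cast_nonneg _) _))
  -- the constants of (19) and (16)
  set c : ℝ := 1024 * C_P' / c₁ with hc_def
  have hc : 0 < c := by positivity
  set c' : ℝ := 2 * C₂' / c₁ + 1 with hc'_def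
  have hc' : 0 < c' := by positivity
  obtain ⟨C_A, hA⟩ := h.landauAvg c hc c' hc'
  refine ⟨max C_A 0 * (C₁' ^ ((3 : ℝ) / 5) * C_P' ^ ((2 : ℝ) / 5)), fun X hX Q₁ hQ₁ hQX => ?_⟩
  set I := (Finset.Ico Q₁ (2 * Q₁)).filter Squarefree with hI
  have hX1 : (1 : ℝ) ≤ X := by exact_mod_cast hX
  have hX0 : (0 : ℝ) < X := by linarith
  have hQpos : (0 : ℝ) < Q₁ := by exact_mod_cast hQ₁
  have hQ1 : (1 : ℝ) ≤ Q₁ := by exact_mod_cast hQ₁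
  have hQX3 : (Q₁ : ℝ) ≤ (X : ℝ) ^ ((1 : ℝ) / 3) :=
    hQX.trans (Real.rpow_le_rpow_of_exponent_le hX1 (by linarith))
  -- the three sums
  have hdhat : ∑ q ∈ I, h.dhat q ≤ C_P' * (Q₁ : ℝ) ^ (2 + ε') :=
    (hP Q₁ hQ₁).trans (mul_le_mul_of_nonneg_right (le_max_left _ _) (Real.rpow_nonneg hQpos.le _))
  have hdhat0 : 0 ≤ ∑ q ∈ I, h.dhat q := Finset.sum_nonneg fun q _ => h.dhat_nonneg q
  have hr₁lo : c₁ / 1024 * (Q₁ : ℝ)⁻¹ ≤ ∑ q ∈ I, h.r₁ q := h.sum_block_r₁_ge hc₁ hlow hQ₁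
  have hr₁hi : ∑ q ∈ I, h.r₁ q ≤ C₁' * (Q₁ : ℝ) ^ (-1 + ε') := h.sum_block_r₁_le hC₁'0 (by linarith) hup₁ hQ₁
  have hr₁0 : 0 ≤ ∑ q ∈ I, h.r₁ q := le_trans (by positivity) hr₁lo
  -- (16) and (19)
  have h16 : ∀ q ∈ I, |h.r₂ q| ≤ c' * (X : ℝ) ^ ((1 : ℝ) / 6) * h.r₁ q := fun q hq =>
    h.cond16 hc₁ hC₂'0 hlow hup₂ hX hQ₁ hQX3 hq
  have h19 : ∑ q ∈ I, h.dhat q ≤ c * X * ∑ q ∈ I, h.r₁ q := by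
    have hQ3 : (Q₁ : ℝ) ^ (3 + ε') ≤ X := rpow_three_add_le hX1 hQpos.le hε' hε'ε hQX
    have hsplit : (Q₁ : ℝ) ^ (2 + ε') = (Q₁ : ℝ) ^ (3 + ε') * (Q₁ : ℝ)⁻¹ := by
      rw [← Real.rpow_neg_one, ← Real.rpow_add hQpos]; ring_nf
    calc ∑ q ∈ I, h.dhat q ≤ C_P' * (Q₁ : ℝ) ^ (2 + ε') := hdhat
      _ = C_P' * ((Q₁ : ℝ) ^ (3 + ε') * (Q₁ : ℝ)⁻¹) := by rw [hsplit]
      _ ≤ C_P' * ((X : ℝ) * (Q₁ : ℝ)⁻¹) := by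
          refine mul_le_mul_of_nonneg_left (mul_le_mul_of_nonneg_right hQ3 (by positivity)) (by positivity)
      _ = c * X * (c₁ / 1024 * (Q₁ : ℝ)⁻¹) := by rw [hc_def]; field_simp
      _ ≤ c * X * ∑ q ∈ I, h.r₁ q := mul_le_mul_of_nonneg_left hr₁lo (by positivity)
  -- Theorem 3.2
  have hmain := hA X hX I (fun q hq => (mem_block hQ₁ hq).1) h16 h19
  -- `(Σ δ₁)^{3/5} (Σ δ̂₁)^{2/5} ≤ C₁'^{3/5} C_P'^{2/5} · Q₁^{1/5} · X^{ε}`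
  have hpow₁ : (∑ q ∈ I, h.r₁ q) ^ ((3 : ℝ) / 5) ≤ C₁' ^ ((3 : ℝ) / 5) * (Q₁ : ℝ) ^ ((-1 + ε') * (3 / 5)) := by
    calc (∑ q ∈ I, h.r₁ q) ^ ((3 : ℝ) / 5) ≤ (C₁' * (Q₁ : ℝ) ^ (-1 + ε')) ^ ((3 : ℝ) / 5) :=
          Real.rpow_le_rpow hr₁0 hr₁hi (by norm_num)
      _ = C₁' ^ ((3 : ℝ) / 5) * (Q₁ : ℝ) ^ ((-1 + ε') * (3 / 5)) := by
          rw [Real.mul_rpow hC₁'0 (Real.rpow_nonneg hQpos.le _), ← Real.rpow_mul hQpos.le]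
  have hpow₂ : (∑ q ∈ I, h.dhat q) ^ ((2 : ℝ) / 5) ≤ C_P' ^ ((2 : ℝ) / 5) * (Q₁ : ℝ) ^ ((2 + ε') * (2 / 5)) := by
    calc (∑ q ∈ I, h.dhat q) ^ ((2 : ℝ) / 5) ≤ (C_P' * (Q₁ : ℝ) ^ (2 + ε')) ^ ((2 : ℝ) / 5) :=
          Real.rpow_le_rpow hdhat0 hdhat (by norm_num)
      _ = C_P' ^ ((2 : ℝ) / 5) * (Q₁ : ℝ) ^ ((2 + ε') * (2 / 5)) := by
          rw [Real.mul_rpow (by positivity) (Real.rpow_nonneg hQpos.le _), ← Real.rpow_mul hQpos.le]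
  have hQε : (Q₁ : ℝ) ^ ((-1 + ε') * (3 / 5)) * (Q₁ : ℝ) ^ ((2 + ε') * (2 / 5)) ≤ (Q₁ : ℝ) ^ ((1 : ℝ) / 5) * (X : ℝ) ^ ε := by
    rw [← Real.rpow_add hQpos, show (-1 + ε') * (3 / 5) + (2 + ε') * (2 / 5) = (1 : ℝ) / 5 + ε' by ring,
      Real.rpow_add hQpos]
    refine mul_le_mul_of_nonneg_left ?_ (Real.rpow_nonneg hQpos.le _)
    calc (Q₁ : ℝ) ^ ε' ≤ ((X : ℝ) ^ ((1 : ℝ) / 3)) ^ ε' := Real.rpow_le_rpow hQpos.le hQX3 hε'.le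
      _ = (X : ℝ) ^ ((1 : ℝ) / 3 * ε') := by rw [← Real.rpow_mul hX0.le]
      _ ≤ (X : ℝ) ^ ε := Real.rpow_le_rpow_of_exponent_le hX1 (by nlinarith)
  have hprod : (∑ q ∈ I, h.r₁ q) ^ ((3 : ℝ) / 5) * (∑ q ∈ I, h.dhat q) ^ ((2 : ℝ) / 5)
      ≤ C₁' ^ ((3 : ℝ) / 5) * C_P' ^ ((2 : ℝ) / 5) * ((Q₁ : ℝ) ^ ((1 : ℝ) / 5) * (X : ℝ) ^ ε) := by
    calc (∑ q ∈ I, h.r₁ q) ^ ((3 : ℝ) / 5) * (∑ q ∈ I, h.dhat q) ^ ((2 : ℝ) / 5)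
        ≤ (C₁' ^ ((3 : ℝ) / 5) * (Q₁ : ℝ) ^ ((-1 + ε') * (3 / 5))) * (C_P' ^ ((2 : ℝ) / 5) * (Q₁ : ℝ) ^ ((2 + ε') * (2 / 5))) :=
          mul_le_mul hpow₁ hpow₂ (Real.rpow_nonneg hdhat0 _) (by positivity)
      _ = C₁' ^ ((3 : ℝ) / 5) * C_P' ^ ((2 : ℝ) / 5) * ((Q₁ : ℝ) ^ ((-1 + ε') * (3 / 5)) * (Q₁ : ℝ) ^ ((2 + ε') * (2 / 5))) := by ring
      _ ≤ C₁' ^ ((3 : ℝ) / 5) * C_P' ^ ((2 : ℝ) / 5) * ((Q₁ : ℝ) ^ ((1 : ℝ) / 5) * (X : ℝ) ^ ε) :=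
          mul_le_mul_of_nonneg_left hQε (by positivity)
  -- assemble
  have hX35 : 0 ≤ (X : ℝ) ^ ((3 : ℝ) / 5) := Real.rpow_nonneg hX0.le _
  calc ∑ q ∈ I, |nonFundCount s q X - h.r₁ q * X - h.r₂ q * (X : ℝ) ^ ((5 : ℝ) / 6)|
      ≤ C_A * (X : ℝ) ^ ((3 : ℝ) / 5) * (∑ q ∈ I, h.r₁ q) ^ ((3 : ℝ) / 5) * (∑ q ∈ I, h.dhat q) ^ ((2 : ℝ) / 5) := hmain
    _ ≤ max C_A 0 * (X : ℝ) ^ ((3 : ℝ) / 5) * ((∑ q ∈ I, h.r₁ q) ^ ((3 : ℝ) / 5) * (∑ q ∈ I, h.dhat q) ^ ((2 : ℝ) / 5)) := by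
        have h0 : 0 ≤ (X : ℝ) ^ ((3 : ℝ) / 5) * ((∑ q ∈ I, h.r₁ q) ^ ((3 : ℝ) / 5) * (∑ q ∈ I, h.dhat q) ^ ((2 : ℝ) / 5)) :=
          mul_nonneg hX35 (mul_nonneg (Real.rpow_nonneg hr₁0 _) (Real.rpow_nonneg hdhat0 _))
        calc C_A * (X : ℝ) ^ ((3 : ℝ) / 5) * (∑ q ∈ I, h.r₁ q) ^ ((3 : ℝ) / 5) * (∑ q ∈ I, h.dhat q) ^ ((2 : ℝ) / 5)
            = C_A * ((X : ℝ) ^ ((3 : ℝ) / 5) * ((∑ q ∈ I, h.r₁ q) ^ ((3 : ℝ) / 5) * (∑ q ∈ I, h.dhat q) ^ ((2 : ℝ) / 5))) := by ring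
          _ ≤ max C_A 0 * ((X : ℝ) ^ ((3 : ℝ) / 5) * ((∑ q ∈ I, h.r₁ q) ^ ((3 : ℝ) / 5) * (∑ q ∈ I, h.dhat q) ^ ((2 : ℝ) / 5))) :=
              mul_le_mul_of_nonneg_right (le_max_left _ _) h0
          _ = _ := by ring
    _ ≤ max C_A 0 * (X : ℝ) ^ ((3 : ℝ) / 5) * (C₁' ^ ((3 : ℝ) / 5) * C_P' ^ ((2 : ℝ) / 5) * ((Q₁ : ℝ) ^ ((1 : ℝ) / 5) * (X : ℝ) ^ ε)) :=
        mul_le_mul_of_nonneg_left hprod (mul_nonneg (le_max_right _ _) hX35)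
    _ = max C_A 0 * (C₁' ^ ((3 : ℝ) / 5) * C_P' ^ ((2 : ℝ) / 5)) * ((X : ℝ) ^ ((3 : ℝ) / 5) * (X : ℝ) ^ ε) * (Q₁ : ℝ) ^ ((1 : ℝ) / 5) := by ring
    _ = max C_A 0 * (C₁' ^ ((3 : ℝ) / 5) * C_P' ^ ((2 : ℝ) / 5)) * (X : ℝ) ^ ((3 : ℝ) / 5 + ε) * (Q₁ : ℝ) ^ ((1 : ℝ) / 5) := by
        rw [← Real.rpow_add hX0]

/-- **`ShintaniFamilyInput ⟹ LandauShintaniData`**: the Landau–Shintani input of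
`FundCubicFieldCountLandau.lean` from Thm 3.2 + the residue formulas + Prop 5.1. [cite: BhargavaTaniguchiThorne2023, §5 (E₁, E₂ paragraphs)] -/
def toLandauShintaniData (h : ShintaniFamilyInput s A) : LandauShintaniData s A where
  r₁ := h.r₁
  r₂ := h.r₂
  abs_r₁_le := h.abs_r₁_le
  hasSum_moebius_mul_r₁ := h.hasSum_moebius_mul_r₁
  abs_r₂_le := h.abs_r₂_le
  landau := h.landau

end ShintaniFamilyInput

/-- **BTT (3) = `btt_fundCubicFieldCount_sum` from Theorem 2.4's residue formulas, Theorem 3.2, Proposition 5.1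
(packaged as `ShintaniFamilyInput` for both signs, `A = 3/π², 2/π²` by (21)) and Proposition 4.5
(`btt_uniformity_sqDvd`)** — the complete §5 argument with exactly the source's three imported theorems
left as inputs. [cite: BhargavaTaniguchiThorne2023, Section 5 (direct proof of (3))] -/
theorem btt_fundCubicFieldCount_sum_of_shintaniFamilyInput
    (hneg : ShintaniFamilyInput (-1) (3 / Real.pi ^ 2)) (hpos : ShintaniFamilyInput 1 (2 / Real.pi ^ 2))
    (hU : btt_uniformity_sqDvd) : btt_fundCubicFieldCount_sum :=
  btt_fundCubicFieldCount_sum_of_landauShintani hneg.toLandauShintaniData hpos.toLandauShintaniData hU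

/-- … and Theorem 1.2 (`btt_threeTorsion_sum`) with the class-field-theory dictionary. [cite: BhargavaTaniguchiThorne2023, §5 ((3) ⟺ Thm 1.2)] -/
theorem btt_threeTorsion_sum_of_shintaniFamilyInput (hdict : threeTorsion_eq_two_mul_cubicFieldCountOfDisc_add_one)
    (hneg : ShintaniFamilyInput (-1) (3 / Real.pi ^ 2)) (hpos : ShintaniFamilyInput 1 (2 / Real.pi ^ 2))
    (hU : btt_uniformity_sqDvd) : btt_threeTorsion_sum :=
  btt_threeTorsion_sum_of_landauShintani hdict hneg.toLandauShintaniData hpos.toLandauShintaniData hU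

end Literature.NumberTheory.CubicFields

end
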